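import Mathlib
import HarnessLib
import Literature.Analysis.FluidPDE.ClassicalNSIRescale
import Literature.Analysis.FluidPDE.DirectionDissipation
import Summits.NavierStokesRegularity.NavierStokesRegularity.Theorems.HalfSpaceWindowDoorCirculationCarryingRigidityDefs
import Summits.NavierStokesRegularity.NavierStokesRegularity.Theorems.HalfSpaceWindowDoorCirculationCarryingRigiditySubcriticalStretching
import Summits.NavierStokesRegularity.NavierStokesRegularity.Theorems.HalfSpaceWindowDoorCirculationCarryingRigidityExtremalProfile
import Summits.NavierStokesRegularity.NavierStokesRegularity.Theorems.SqueezeCycleExtremalElementExistsRescale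
import Summits.NavierStokesRegularity.NavierStokesRegularity.Theorems.SqueezeCycleExtremalElementExistsExtraction
import Summits.NavierStokesRegularity.NavierStokesRegularity.Theorems.SqueezeCycleExtremalElementExistsRegularity

/-!
# Route `HalfSpaceWindowDoor`, crux `CirculationCarryingRigidity` (stmt-NavierStokesRegularity-25311) —
# extremal profiles in an INVARIANT SUB-CLASS, and the `e₃`-stretching under zooms and limits

Companion of `…ExtremalProfile` (where the supremum of the scale-invariant `e₃`-vorticity `(−s)·⟪curl v(s)(y), e₃⟫`
over the closed-hemisphere part of `IsTypeIAncientMild C` is shown to be attained).  Here the same construction is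
run inside an ARBITRARY sub-class `Q` that is invariant under the Navier–Stokes zooms `v ↦ c v(c²·, x₀ + c·)` and
closed under the pointwise `C¹` limits delivered by the class compactness — so that structural hypotheses on a
profile (sign conditions, stretching bounds, symmetries) are INHERITED by its extremal companion:

* `inner_stretch_zoom` — the `e₃`-stretching `σ = ⟪Dv[curl v], e₃⟫` of the zoom `c v(c²s, x₀ + c y)` is `c⁴ σ ∘ Φ`;
* `critical_zoom`, `critical_lim` — the CRITICAL stretching bound `(−s)σ ≤ ω₃` (similarity rate) is zoom-invariant
  and closed under pointwise `C¹` limits;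
* `exists_extremal_of_invariant` — **extremal element of an invariant sub-class**: if a member `u` of `Q` has
  `⟪curl u(t₁)(x₁), e₃⟫ > 0`, there are `W ∈ Q` (same `C`) and `M > 0` with `⟪curl W(−1)(0), e₃⟫ = M` and
  `(−t)·⟪curl v(t)(x), e₃⟫ ≤ M` for every `v ∈ Q` (KNSS Prop. 4.1 gradient bound, zoom normalisation, `C¹_loc`
  compactness `exists_tendsto_of_isTypeIAncientMild_seq`).

Consumed by `…CriticalStretching` (the `θ = 1` exclusion).  Seat ns-hsw-p1 g2 (LEAD of 25311, cell pub-ns-dss;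
helper `--supports` 25311).  WHAT THIS IS NOT: not a statement about Navier–Stokes regularity — the door statements
are regularity CRITERIA about HYPOTHETICAL blow-up profiles; a tool for strata of the open stub, not its closure.
-/

noncomputable section

-- the summit and its single sub-problem share the name (CONVENTIONS §1), as in every Theorems file
set_option linter.dupNamespace false

namespace Summit.NavierStokesRegularity.NavierStokesRegularity.Theorems.HalfSpaceWindowDoorCirculationCarryingRigidityExtremalInvariant

open Set Function Filter Topology Metric
open scoped RealInnerProductSpace InnerProductSpace ContDiff
open Literature.Analysis Literature.Analysis.FluidPDE
open Summit.NavierStokesRegularity.NavierStokesRegularity.Theorems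
open Summit.NavierStokesRegularity.NavierStokesRegularity.Theorems.HalfSpaceWindowDoorCirculationCarryingRigidityDefs
open Summit.NavierStokesRegularity.NavierStokesRegularity.Theorems.HalfSpaceWindowDoorCirculationCarryingRigiditySubcriticalStretching
  (inner_e3_le_norm)
open Summit.NavierStokesRegularity.NavierStokesRegularity.Theorems.HalfSpaceWindowDoorCirculationCarryingRigidityExtremalProfile
  (inner_curl_zoom_e3 tendsto_inner_curl_e3_of_tendsto_fderiv)

/-! ### The `e₃`-stretching under the Navier–Stokes zoom and under `C¹` limits -/

/-- **Stretching of the zoomed field**: for the zoom `w = c • stPull (c²) c 0 x₀ u`, `w(s,y) = c u(c²s, x₀ + c y)`, with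
`u(c²s)` differentiable, `⟪Dw(s,y)[curl w(s,y)], e₃⟫ = c⁴ ⟪Du(c²s, x₀ + c y)[curl u(c²s, x₀ + c y)], e₃⟫`
(`Dw = c² Du ∘ Φ`, `curl w = c² curl u ∘ Φ`). [folklore] -/
theorem inner_stretch_zoom (c : ℝ) (x₀ : EuclideanSpace ℝ (Fin 3))
    (u : ℝ → EuclideanSpace ℝ (Fin 3) → EuclideanSpace ℝ (Fin 3)) (s : ℝ) (y : EuclideanSpace ℝ (Fin 3))
    (hd : Differentiable ℝ (u (c ^ 2 * s))) :
    ⟪fderiv ℝ ((c • stPull (c ^ 2) c 0 x₀ u) s) y (curl ((c • stPull (c ^ 2) c 0 x₀ u) s) y), e3⟫ =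
      c ^ 4 * ⟪fderiv ℝ (u (c ^ 2 * s)) (x₀ + c • y) (curl (u (c ^ 2 * s)) (x₀ + c • y)), e3⟫ := by
  have hd' : Differentiable ℝ (u (0 + c ^ 2 * s)) := by rwa [zero_add]
  rw [fderiv_smul_stPull_slice hd' y, curl_smul_stPull, zero_add, FunLike.coe_smul, Pi.smul_apply,
    map_smul,
    smul_smul, real_inner_smul_left]
  ring

/-- The critical stretching bound `(−s)·⟪Dv[curl v], e₃⟫ ≤ ⟪curl v, e₃⟫` is invariant under the zoom (both sides scale
by `c²` after the substitution `s ↦ c²s`). [folklore] -/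
theorem critical_zoom {C : ℝ} {u : ℝ → EuclideanSpace ℝ (Fin 3) → EuclideanSpace ℝ (Fin 3)}
    (hu : IsTypeIAncientMild C u)
    (hcrit : ∀ t < 0, ∀ x, (-t) * ⟪fderiv ℝ (u t) x (curl (u t) x), e3⟫ ≤ ⟪curl (u t) x, e3⟫)
    {c : ℝ} (hc : 0 < c) (x₀ : EuclideanSpace ℝ (Fin 3)) :
    ∀ s < 0, ∀ y, (-s) * ⟪fderiv ℝ ((c • stPull (c ^ 2) c 0 x₀ u) s) y
        (curl ((c • stPull (c ^ 2) c 0 x₀ u) s) y), e3⟫ ≤ ⟪curl ((c • stPull (c ^ 2) c 0 x₀ u) s) y, e3⟫ := by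
  intro s hs y
  have hcs : c ^ 2 * s < 0 := mul_neg_of_pos_of_neg (pow_pos hc 2) hs
  have hd : Differentiable ℝ (u (c ^ 2 * s)) :=
    (hu.contDiff_slice hcs).differentiable (by simp)
  rw [inner_stretch_zoom c x₀ u s y hd, inner_curl_zoom_e3]
  have h := hcrit (c ^ 2 * s) hcs (x₀ + c • y)
  have hc2 : 0 ≤ c ^ 2 := sq_nonneg c
  calc (-s) * (c ^ 4 * ⟪fderiv ℝ (u (c ^ 2 * s)) (x₀ + c • y) (curl (u (c ^ 2 * s)) (x₀ + c • y)), e3⟫)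
      = c ^ 2 * ((-(c ^ 2 * s)) * ⟪fderiv ℝ (u (c ^ 2 * s)) (x₀ + c • y) (curl (u (c ^ 2 * s)) (x₀ + c • y)), e3⟫) := by
        ring
    _ ≤ c ^ 2 * ⟪curl (u (c ^ 2 * s)) (x₀ + c • y), e3⟫ := mul_le_mul_of_nonneg_left h hc2

/-- The critical stretching bound passes to pointwise `C¹` limits (`Dv_j → DW` pointwise gives `curl v_j → curl W` and
`⟪Dv_j[curl v_j], e₃⟫ → ⟪DW[curl W], e₃⟫`). [folklore] -/
theorem critical_lim {w : ℕ → ℝ → EuclideanSpace ℝ (Fin 3) → EuclideanSpace ℝ (Fin 3)}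
    {W : ℝ → EuclideanSpace ℝ (Fin 3) → EuclideanSpace ℝ (Fin 3)}
    (hcrit : ∀ j, ∀ t < 0, ∀ x, (-t) * ⟪fderiv ℝ (w j t) x (curl (w j t) x), e3⟫ ≤ ⟪curl (w j t) x, e3⟫)
    (hD : ∀ t < 0, ∀ x, Tendsto (fun j => fderiv ℝ (w j t) x) atTop (𝓝 (fderiv ℝ (W t) x))) :
    ∀ t < 0, ∀ x, (-t) * ⟪fderiv ℝ (W t) x (curl (W t) x), e3⟫ ≤ ⟪curl (W t) x, e3⟫ := by
  intro t ht x
  have hc : Tendsto (fun j => curl (w j t) x) atTop (𝓝 (curl (W t) x)) := by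
    simp_rw [curl_eq_curlCLM]
    exact (curlCLM.continuous.tendsto _).comp (hD t ht x)
  have happ : Tendsto (fun j => fderiv ℝ (w j t) x (curl (w j t) x)) atTop (𝓝 (fderiv ℝ (W t) x (curl (W t) x))) :=
    (isBoundedBilinearMap_apply.continuous.tendsto _).comp ((hD t ht x).prodMk_nhds hc)
  have hl : Tendsto (fun j => (-t) * ⟪fderiv ℝ (w j t) x (curl (w j t) x), e3⟫) atTop
      (𝓝 ((-t) * ⟪fderiv ℝ (W t) x (curl (W t) x), e3⟫)) :=
    (happ.inner tendsto_const_nhds).const_mul _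
  exact le_of_tendsto_of_tendsto' hl (tendsto_inner_curl_e3_of_tendsto_fderiv (hD t ht x)) fun j => hcrit j t ht x

/-! ### Extremal profiles in an invariant sub-class -/

/-- **Extremal element of an invariant sub-class.**  Let `Q` be a property of profiles that is invariant under the
Navier–Stokes zooms `v ↦ c v(c²·, x₀ + c·)` (`c > 0`) of members of `IsTypeIAncientMild C` and closed under the
pointwise `C¹` limits produced by the class compactness (`exists_tendsto_of_isTypeIAncientMild_seq`).  If some member
`u` with `Q u` has `⟪curl u(t₁)(x₁), e₃⟫ > 0`, then there are a member `W` with `Q W` and `M > 0` such that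
`⟪curl W(−1)(0), e₃⟫ = M` and `(−t)·⟪curl v(t)(x), e₃⟫ ≤ M` for every member `v` with `Q v`, all `t < 0`, `x`
(the proof of `…ExtremalProfile.exists_extremal_typeIAncientMild`, verbatim with `Q` for the sign clause).
[cite: KochNadirashviliSereginSverak2009, Prop. 4.1 and Lemma 6.1 (arXiv:0709.3599 pp. 8, 11)] -/
theorem exists_extremal_of_invariant (C : ℝ)
    (Q : (ℝ → EuclideanSpace ℝ (Fin 3) → EuclideanSpace ℝ (Fin 3)) → Prop)
    (hQzoom : ∀ v, IsTypeIAncientMild C v → Q v → ∀ c : ℝ, 0 < c → ∀ x₀ : EuclideanSpace ℝ (Fin 3),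
      Q (c • stPull (c ^ 2) c 0 x₀ v))
    (hQlim : ∀ (w : ℕ → ℝ → EuclideanSpace ℝ (Fin 3) → EuclideanSpace ℝ (Fin 3))
      (W : ℝ → EuclideanSpace ℝ (Fin 3) → EuclideanSpace ℝ (Fin 3)),
      (∀ j, IsTypeIAncientMild C (w j)) → (∀ j, Q (w j)) → IsTypeIAncientMild C W →
      (∀ t < 0, ∀ x, Tendsto (fun j => fderiv ℝ (w j t) x) atTop (𝓝 (fderiv ℝ (W t) x))) → Q W)
    {u : ℝ → EuclideanSpace ℝ (Fin 3) → EuclideanSpace ℝ (Fin 3)} (hu : IsTypeIAncientMild C u) (hQu : Q u)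
    {t₁ : ℝ} (ht₁ : t₁ < 0) {x₁ : EuclideanSpace ℝ (Fin 3)} (hpos : 0 < ⟪curl (u t₁) x₁, e3⟫) :
    ∃ W : ℝ → EuclideanSpace ℝ (Fin 3) → EuclideanSpace ℝ (Fin 3), IsTypeIAncientMild C W ∧ Q W ∧
      ∃ M : ℝ, 0 < M ∧ ⟪curl (W (-1)) 0, e3⟫ = M ∧
        ∀ v : ℝ → EuclideanSpace ℝ (Fin 3) → EuclideanSpace ℝ (Fin 3), IsTypeIAncientMild C v → Q v →
          ∀ t < 0, ∀ x, (-t) * ⟪curl (v t) x, e3⟫ ≤ M := by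
  -- ## the normalisation to `(-1, 0)` by the zoom about `(0, x)` with factor `√(-t)`
  have hzoom : ∀ v : ℝ → EuclideanSpace ℝ (Fin 3) → EuclideanSpace ℝ (Fin 3),
      IsTypeIAncientMild C v → Q v → ∀ t < 0, ∀ x,
        ∃ v' : ℝ → EuclideanSpace ℝ (Fin 3) → EuclideanSpace ℝ (Fin 3),
          IsTypeIAncientMild C v' ∧ Q v' ∧ ⟪curl (v' (-1)) 0, e3⟫ = (-t) * ⟪curl (v t) x, e3⟫ := by
    intro v hv hvq t ht x
    set c : ℝ := Real.sqrt (-t) with hcdef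
    have hc : 0 < c := Real.sqrt_pos.2 (neg_pos.2 ht)
    have hc2 : c ^ 2 = -t := Real.sq_sqrt (neg_pos.2 ht).le
    refine ⟨c • stPull (c ^ 2) c 0 x v, isTypeIAncientMild_zoom hv hc x, hQzoom v hv hvq c hc x, ?_⟩
    rw [inner_curl_zoom_e3, smul_zero, add_zero, hc2, show -t * (-1) = t by ring]
  -- ## the class-uniform bound at `t = -1`, hence everywhere
  obtain ⟨K, hK⟩ := exists_norm_iteratedFDeriv_le_of_typeI C 1 (a := -3) (b := -(1 / 2)) (δ := 1)
    (by norm_num) (by norm_num) one_pos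
  have hK1 : ∀ v : ℝ → EuclideanSpace ℝ (Fin 3) → EuclideanSpace ℝ (Fin 3),
      IsTypeIAncientMild C v → ⟪curl (v (-1)) 0, e3⟫ ≤ 4 * K := by
    intro v hv
    have h := hK hv.continuousOn_uncurry (fun t ht => hv.isWeaklyDivFree ht)
      (fun s t hst ht x => hv.mild_eq_heatExtension hst ht x) hv.hasTypeITimeDecay (-1)
      ⟨by norm_num, by norm_num⟩ 0
    rw [norm_iteratedFDeriv_one] at h
    calc ⟪curl (v (-1)) 0, e3⟫ ≤ ‖curl (v (-1)) 0‖ := inner_e3_le_norm _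
      _ ≤ 4 * ‖fderiv ℝ (v (-1)) 0‖ := norm_curl_le_four_mul (v (-1)) 0
      _ ≤ 4 * K := by gcongr
  have hbound : ∀ v : ℝ → EuclideanSpace ℝ (Fin 3) → EuclideanSpace ℝ (Fin 3),
      IsTypeIAncientMild C v → Q v → ∀ t < 0, ∀ x, (-t) * ⟪curl (v t) x, e3⟫ ≤ 4 * K := by
    intro v hv hvq t ht x
    obtain ⟨v', hv', -, heq⟩ := hzoom v hv hvq t ht x
    rw [← heq]
    exact hK1 v' hv'
  -- ## the supremum
  set S : Set ℝ := {Λ | ∃ (v : ℝ → EuclideanSpace ℝ (Fin 3) → EuclideanSpace ℝ (Fin 3)) (t : ℝ)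
    (x : EuclideanSpace ℝ (Fin 3)), IsTypeIAncientMild C v ∧ Q v ∧ t < 0 ∧
      Λ = (-t) * ⟪curl (v t) x, e3⟫} with hS
  have hSbdd : BddAbove S :=
    ⟨4 * K, by rintro Λ ⟨v, t, x, hv, hvq, ht, rfl⟩; exact hbound v hv hvq t ht x⟩
  have hmemS : ∀ v t x, IsTypeIAncientMild C v → Q v → t < 0 → (-t) * ⟪curl (v t) x, e3⟫ ∈ S :=
    fun v t x hv hvq ht => ⟨v, t, x, hv, hvq, ht, rfl⟩
  have hSne : S.Nonempty := ⟨_, hmemS u t₁ x₁ hu hQu ht₁⟩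
  set M : ℝ := sSup S with hM
  have hle : ∀ v t x, IsTypeIAncientMild C v → Q v → t < 0 → (-t) * ⟪curl (v t) x, e3⟫ ≤ M :=
    fun v t x hv hvq ht => le_csSup hSbdd (hmemS v t x hv hvq ht)
  have hMpos : 0 < M :=
    (mul_pos (neg_pos.2 ht₁) hpos).trans_le (hle u t₁ x₁ hu hQu ht₁)
  -- ## a maximising sequence, normalised to `(-1, 0)`
  obtain ⟨Λs, -, hΛlim, hΛmem⟩ := exists_seq_tendsto_sSup hSne hSbdd
  have hseq : ∀ k, ∃ w : ℝ → EuclideanSpace ℝ (Fin 3) → EuclideanSpace ℝ (Fin 3),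
      IsTypeIAncientMild C w ∧ Q w ∧ ⟪curl (w (-1)) 0, e3⟫ = Λs k := by
    intro k
    obtain ⟨v, t, x, hv, hvq, ht, hΛ⟩ := hΛmem k
    obtain ⟨v', hv', hvq', heq⟩ := hzoom v hv hvq t ht x
    exact ⟨v', hv', hvq', by rw [heq, hΛ]⟩
  choose w hwc hwq hwΛ using hseq
  -- ## compactness
  obtain ⟨φ, hφ, W, hWc, -, hptG, -, -⟩ := exists_tendsto_of_isTypeIAncientMild_seq C hwc
  have hcurl : ∀ t < 0, ∀ x, Tendsto (fun j => ⟪curl (w (φ j) t) x, e3⟫) atTop (𝓝 ⟪curl (W t) x, e3⟫) :=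
    fun t ht x => tendsto_inner_curl_e3_of_tendsto_fderiv (hptG t ht x)
  have hWq : Q W := hQlim (fun j => w (φ j)) W (fun j => hwc (φ j)) (fun j => hwq (φ j)) hWc hptG
  -- ## the supremum is attained at `(-1, 0)` by `W`
  have hMW : ⟪curl (W (-1)) 0, e3⟫ = M := by
    have h1 : Tendsto (fun j => ⟪curl (w (φ j) (-1)) 0, e3⟫) atTop (𝓝 M) := by
      have h := hΛlim.comp hφ.tendsto_atTop
      exact h.congr fun j => by simp only [comp_apply, hwΛ]
    exact tendsto_nhds_unique (hcurl (-1) (by norm_num) 0) h1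
  exact ⟨W, hWc, hWq, M, hMpos, hMW, fun v hv hvq t ht x => hle v t x hv hvq ht⟩

end Summit.NavierStokesRegularity.NavierStokesRegularity.Theorems.HalfSpaceWindowDoorCirculationCarryingRigidityExtremalInvariant

end
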